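import Summits.ResolutionOfSingularities.ResolutionOfSingularities.Theorems.FrobeniusClosingPatchingRelPerfectCuspDepthFourLineStepAlgebra
import Summits.ResolutionOfSingularities.ResolutionOfSingularities.Theorems.FrobeniusClosingPatchingRelPerfectTangentEuclidTwoBeta
import HarnessLib

/-!
# Crux `PatchingRelPerfect` (stmt-ResolutionOfSingularities-16161), chain w52 — kernel certificate of
# the NON-GRADED DEPTH-FOUR member `(x₃² + x₀³) + 𝔪⁶`, part 2a: the SURFACE STEP `Π₂` on the
# `a`-chart and the hand-over to tangent Euclid `(2, 4)` (ring level)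

[OURS · L1 W5.2 · kernel (iii) beyond F6, CHAIN v2.0 §1 (C)] After the line step (parts 1a/1b,
`…CuspDepthFourLineStepAlgebra.lean` p528899, `…CuspDepthFourLineStep.lean`) the residual on the
`a`-chart ring `B` is `F′ = (a, c′) · (c′, a t′) · ((c′² + t′ a²) + (a² t′⁴)) ·
∏_{k<6} ((a^k (c′² + t′ a²)) + (c′^{k+2}) + (a^{k+2} t′^{2k+4}))` (note `NONGRADED-DEPTH4-MEMBER.md`
§2–§3, evidence #59; chart table kit j276688).  This file blows up the SURFACE `Π₂ = V(a, c′)`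
(the first factor): on the `c′`-chart every factor is a principal monomial; on the `a`-chart the
residual is EXACTLY the tangent-Euclid product of `CoreRungTower.tangent_euclid_two 3` (p527008) in
the letters `(t′, c″)`, `c′ = a c″` — host `t′ + c″²`, `(t′⁴)`, avatars `(t′ + c″²) + (c″^{k+2})`,
tangency locus `(t′, c″)` — times the monomial `a · a² · a²⁷`.  Hence
`isRegular_of_isBlowup_surfaceStep`: for `(a, c′)` quasi-regular with `B/(a, c′)` regular in a
regular ring `B`, and `(t′/1, c″)` quasi-regular with regular quotient on the `a`-chart of
`Bl_{(a, c′)}` (the two PERSISTENCE facts, supplied by part 2b from the line step's hypotheses),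
every blowing up of `Spec B` along `F′` is regular.  FORMAT evidence for the core on the
`𝔪`-primary stratum; nothing here is a statement of the manuscript under review.

## References

* The Stacks Project, Tags 0804, 080A, 080B, 0BIQ. [StacksProject]
* Q. Liu, *Algebraic Geometry and Arithmetic Curves*, OUP 2002, Thm. 8.1.19 (a). [Liu2002]
-/

-- `Summit.<Summit>.<Sub>.Theorems` with `Sub = Summit` (single-conjunct summit, D-0017)
set_option linter.dupNamespace false

noncomputable section

open CategoryTheory CategoryTheory.Limits AlgebraicGeometry Literature.AlgebraicGeometry.Resolution
open scoped Pointwise nonZeroDivisors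

namespace Summit.ResolutionOfSingularities.ResolutionOfSingularities.Theorems

universe u

namespace CuspDepthFour

/-! ## Notation (as in part 1): the `a`-chart residual factors -/

/-- `a`-chart residual of `P`: the surface `Π₂ = (a, c′)`. -/
local notation3 "Pa[" t "," c "," a "]" => (Ideal.span {a} ⊔ Ideal.span {c})
/-- `a`-chart residual of `Σ`: `(c′, a t′)`. -/
local notation3 "Sa[" t "," c "," a "]" => (Ideal.span {c} ⊔ Ideal.span {a * t})
/-- `a`-chart residual of `K`: `(c′² + t′ a²) + (a² t′⁴)`. -/
local notation3 "Ka[" t "," c "," a "]" => (Ideal.span {c ^ 2 + t * a ^ 2} ⊔ Ideal.span {a ^ 2 * t ^ 4})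
/-- `a`-chart residual of `B_{k+2}`. -/
local notation3 "Ba[" t "," c "," a "," k "]" =>
  (Ideal.span {a ^ k * (c ^ 2 + t * a ^ 2)} ⊔ Ideal.span {c ^ (k + 2)} ⊔ Ideal.span {a ^ (k + 2) * t ^ (2 * k + 4)})
/-- The `a`-chart residual without the centre `(a, c′)`. -/
local notation3 "Ga[" t "," c "," a "]" =>
  (Sa[t,c,a] * Ka[t,c,a] * ∏ k ∈ Finset.range 6, Ba[t,c,a,k])
/-- The full `a`-chart residual. -/
local notation3 "Fa[" t "," c "," a "]" =>
  (Pa[t,c,a] * Sa[t,c,a] * Ka[t,c,a] * ∏ k ∈ Finset.range 6, Ba[t,c,a,k])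
/-- The tangent-Euclid product of `CoreRungTower.tangent_euclid_two 3` (`η = 1`). -/
local notation3 "TE[" t "," c "]" =>
  (((Ideal.span {1 * t + c ^ 2} ⊔ Ideal.span {t ^ (3 + 1)}) *
    ∏ k ∈ Finset.range (2 * 3), (Ideal.span {1 * t + c ^ 2} ⊔ Ideal.span {c ^ (k + 2)})) *
    Ideal.span (Set.range ![t, c]))

section Algebra

variable {A : Type u} [CommRing A]

/-! ### `a`-sub-chart identities (`c′ = a c″`) -/

/-- `Σ′ ↦ a · (t′, c″)`. [folklore] -/
theorem aSub_S (a t c'' : A) :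
    Sa[t, a * c'', a] = Ideal.span {a} * Ideal.span (Set.range ![t, c'']) := by
  rw [CuspMember.span_range_vec2, Ideal.mul_sup, Ideal.span_singleton_mul_span_singleton,
    Ideal.span_singleton_mul_span_singleton, sup_comm]

/-- `K′ ↦ a² · ((t′ + c″²) + (t′⁴))`. [folklore] -/
theorem aSub_K (a t c'' : A) :
    Ka[t, a * c'', a] = Ideal.span {a ^ 2} * (Ideal.span {1 * t + c'' ^ 2} ⊔ Ideal.span {t ^ (3 + 1)}) := by
  rw [Ideal.mul_sup, Ideal.span_singleton_mul_span_singleton, Ideal.span_singleton_mul_span_singleton]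
  have e1 : (a * c'') ^ 2 + t * a ^ 2 = a ^ 2 * (1 * t + c'' ^ 2) := by ring
  have e2 : a ^ 2 * t ^ 4 = a ^ 2 * t ^ (3 + 1) := by ring
  rw [e1, e2]

/-- `B′_{k+2} ↦ a^{k+2} · ((t′ + c″²) + (c″^{k+2}))` (`t′^{2k+4} ≡ c″^{4k+8}` modulo the host).
[folklore] -/
theorem aSub_B (a t c'' : A) (k : ℕ) :
    Ba[t, a * c'', a, k] = Ideal.span {a ^ (k + 2)} * (Ideal.span {1 * t + c'' ^ 2} ⊔ Ideal.span {c'' ^ (k + 2)}) := by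
  rw [Ideal.mul_sup, Ideal.span_singleton_mul_span_singleton, Ideal.span_singleton_mul_span_singleton]
  have e1 : a ^ k * ((a * c'') ^ 2 + t * a ^ 2) = a ^ (k + 2) * (1 * t + c'' ^ 2) := by ring
  have e2 : (a * c'') ^ (k + 2) = a ^ (k + 2) * c'' ^ (k + 2) := by ring
  rw [e1, e2]
  refine sup_eq_left.mpr ?_
  rw [Ideal.span_singleton_le_iff_mem, ← Ideal.span_singleton_mul_span_singleton,
    ← Ideal.span_singleton_mul_span_singleton, ← Ideal.mul_sup]
  refine Ideal.mul_mem_mul (Ideal.mem_span_singleton_self _) ?_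
  -- `t^{2k+4} ∈ (t + c″²) + (c″^{k+2})`: modulo the host, `t ≡ -c″²`
  have hP : t ^ (2 * k + 4) ∈ Ideal.span {1 * t + c'' ^ 2} ⊔ Ideal.span {c'' ^ (k + 2)} := by
    have e : t ^ (2 * k + 4) = (t ^ (2 * k + 4) - (-(c'' ^ 2)) ^ (2 * k + 4)) + (-(c'' ^ 2)) ^ (2 * k + 4) := by
      ring
    rw [e]
    refine Submodule.add_mem _ (Ideal.mem_sup_left ?_) (Ideal.mem_sup_right ?_)
    · have hd := sub_dvd_pow_sub_pow t (-(c'' ^ 2)) (2 * k + 4)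
      have e' : t - -(c'' ^ 2) = 1 * t + c'' ^ 2 := by ring
      rw [e'] at hd
      exact Ideal.mem_span_singleton.mpr hd
    · refine Ideal.mem_span_singleton.mpr ⟨(-1) ^ (2 * k + 4) * c'' ^ (3 * k + 6), ?_⟩
      ring
  exact hP

/-- Collecting the twist on the `a`-sub-chart and reordering into the tangent-Euclid product.
[folklore] -/
theorem collect_aSub (g : A) (Z K : Ideal A) (B E : ℕ → Ideal A)
    (hB : ∀ k, B k = Ideal.span {g ^ (k + 2)} * E k) :
    Ideal.span {g} * Z * (Ideal.span {g ^ 2} * K) * ∏ k ∈ Finset.range 6, B k =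
      Ideal.span {g * g ^ 2 * g ^ 27} * (K * (∏ k ∈ Finset.range (2 * 3), E k) * Z) := by
  simp_rw [hB]
  rw [Finset.prod_mul_distrib, Ideal.prod_span_singleton, Finset.prod_pow_eq_pow_sum, sum_range_six,
    ← Ideal.span_singleton_mul_span_singleton, ← Ideal.span_singleton_mul_span_singleton]
  have e : Finset.range (2 * 3) = Finset.range 6 := rfl
  rw [e]
  ring

/-! ### `c′`-sub-chart identities (`a = c′ a″`): everything principal -/

/-- `Σ′ ↦ (c′)`. [folklore] -/
theorem cSub_S' (C t a'' : A) : Sa[t, C, C * a''] = Ideal.span {C} :=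
  sup_eq_left.mpr (Ideal.span_singleton_le_span_singleton.mpr ⟨a'' * t, by ring⟩)

/-- `K′ ↦ (c′²)` (`1 + t′ a″²` is a unit up to nilpotents modulo `(a″² t′⁴)`). [folklore] -/
theorem cSub_K' (C t a'' : A) : Ka[t, C, C * a''] = Ideal.span {C ^ 2} := by
  have e1 : C ^ 2 + t * (C * a'') ^ 2 = C ^ 2 * (1 + t * a'' ^ 2) := by ring
  have e2 : (C * a'') ^ 2 * t ^ 4 = C ^ 2 * (a'' ^ 2 * t ^ 4) := by ring
  rw [e1, e2, ← Ideal.span_singleton_mul_span_singleton, ← Ideal.span_singleton_mul_span_singleton,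
    ← Ideal.mul_sup]
  have hP : Ideal.span {1 + t * a'' ^ 2} ⊔ Ideal.span {a'' ^ 2 * t ^ 4} = ⊤ := by
    refine CoreRungTower.eq_top_of_isUnit_eq_sub isUnit_one (h := 1 + t * a'' ^ 2)
      (n := t * a'' ^ 2) (by ring) _ 1 4 ?_ ?_
    · rw [pow_one]; exact Ideal.mem_sup_left (Ideal.mem_span_singleton_self _)
    · refine Ideal.mem_sup_right (Ideal.mem_span_singleton.mpr ⟨a'' ^ 6, ?_⟩)
      ring
  rw [hP, Ideal.mul_top]

/-- `B′_{k+2} ↦ (c′^{k+2})`. [folklore] -/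
theorem cSub_B' (C t a'' : A) (k : ℕ) : Ba[t, C, C * a'', k] = Ideal.span {C ^ (k + 2)} := by
  have h1 : Ideal.span {(C * a'') ^ k * (C ^ 2 + t * (C * a'') ^ 2)} ≤ Ideal.span {C ^ (k + 2)} :=
    Ideal.span_singleton_le_span_singleton.mpr ⟨a'' ^ k * (1 + t * a'' ^ 2), by ring⟩
  have h2 : Ideal.span {(C * a'') ^ (k + 2) * t ^ (2 * k + 4)} ≤ Ideal.span {C ^ (k + 2)} :=
    Ideal.span_singleton_le_span_singleton.mpr ⟨a'' ^ (k + 2) * t ^ (2 * k + 4), by ring⟩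
  exact le_antisymm (sup_le (sup_le h1 le_rfl) h2) (le_sup_of_le_left le_sup_right)

/-- Peeling the centre off the `a`-chart residual: `F′ = G′ · (a, c′)`. [folklore] -/
theorem Fa_eq (t c a : A) : Fa[t,c,a] = Ga[t,c,a] * Ideal.span (Set.range ![a, c]) := by
  rw [CuspMember.span_range_vec2]
  ring

end Algebra

/-! ## The two charts of `Bl_{(a, c′)}` -/

section Charts

variable {B : Type u} [CommRing B] (T C A₁ : B)

local notation3 "yy" => (![A₁, C] : Fin 2 → B)

set_option maxHeartbeats 400000 in
-- instance-path defeq through `HomogeneousLocalization`'s standalone `Pow`/`Mul` (as in p508825)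
/-- **`a`-sub-chart image**: `G′ · B_a = (a · a² · a²⁷) · TE(t′/1, c″)`, the tangent-Euclid product
of `CoreRungTower.tangent_euclid_two 3`. [cite: StacksProject, Tag 0804] -/
theorem map_Ga_zero :
    (Ga[T,C,A₁]).map (chartBase yy 0) =
      Ideal.span {chartBase yy 0 A₁ * chartBase yy 0 A₁ ^ 2 * chartBase yy 0 A₁ ^ 27} *
        TE[chartBase yy 0 T, chartGen yy 0 1] := by
  have cb : chartBase yy 0 C = chartBase yy 0 A₁ * chartGen yy 0 1 :=
    reesChartBase_apply_eq_mul_chartGen yy 0 1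
  have hS : (Sa[T,C,A₁]).map (chartBase yy 0) =
      Ideal.span {chartBase yy 0 A₁} * Ideal.span (Set.range ![chartBase yy 0 T, chartGen yy 0 1]) := by
    rw [Ideal.map_sup, CuspMember.map_span_singleton, CuspMember.map_span_singleton, map_mul, cb]
    exact aSub_S _ _ _
  have hK : (Ka[T,C,A₁]).map (chartBase yy 0) =
      Ideal.span {chartBase yy 0 A₁ ^ 2} * (Ideal.span {1 * chartBase yy 0 T + chartGen yy 0 1 ^ 2} ⊔
        Ideal.span {chartBase yy 0 T ^ (3 + 1)}) := by
    rw [Ideal.map_sup, CuspMember.map_span_singleton, CuspMember.map_span_singleton, map_add, map_pow,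
      map_mul, map_pow, map_mul, map_pow, map_pow, cb]
    exact aSub_K _ _ _
  have hB : ∀ k : ℕ, (Ba[T,C,A₁,k]).map (chartBase yy 0) =
      Ideal.span {chartBase yy 0 A₁ ^ (k + 2)} * (Ideal.span {1 * chartBase yy 0 T + chartGen yy 0 1 ^ 2} ⊔
        Ideal.span {chartGen yy 0 1 ^ (k + 2)}) := by
    intro k
    rw [Ideal.map_sup, Ideal.map_sup, CuspMember.map_span_singleton, CuspMember.map_span_singleton,
      CuspMember.map_span_singleton, map_mul, map_pow, map_add, map_pow, map_mul, map_pow, map_pow,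
      map_mul, map_pow, map_pow, cb]
    exact aSub_B _ _ _ k
  rw [Ideal.map_mul, Ideal.map_mul, CoreRungTower.map_prod_range, hS, hK]
  exact collect_aSub _ _ _ _ _ hB

set_option maxHeartbeats 400000 in
-- instance-path defeq through `HomogeneousLocalization`'s standalone `Pow`/`Mul` (as in p508825)
/-- **`c′`-sub-chart image**: `G′ · B_{c′}` is the principal monomial `(c′ · c′² · c′²⁷)`.
[cite: StacksProject, Tag 0804] -/
theorem map_Ga_one :
    (Ga[T,C,A₁]).map (chartBase yy 1) =
      Ideal.span {chartBase yy 1 C * chartBase yy 1 C ^ 2 * chartBase yy 1 C ^ 27} := by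
  have cb : chartBase yy 1 A₁ = chartBase yy 1 C * chartGen yy 1 0 :=
    reesChartBase_apply_eq_mul_chartGen yy 1 0
  have hS : (Sa[T,C,A₁]).map (chartBase yy 1) = Ideal.span {chartBase yy 1 C} := by
    rw [Ideal.map_sup, CuspMember.map_span_singleton, CuspMember.map_span_singleton, map_mul, cb]
    exact cSub_S' _ _ _
  have hK : (Ka[T,C,A₁]).map (chartBase yy 1) = Ideal.span {chartBase yy 1 C ^ 2} := by
    rw [Ideal.map_sup, CuspMember.map_span_singleton, CuspMember.map_span_singleton, map_add, map_pow,
      map_mul, map_pow, map_mul, map_pow, map_pow, cb]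
    exact cSub_K' _ _ _
  have hB : ∀ k : ℕ, (Ba[T,C,A₁,k]).map (chartBase yy 1) = Ideal.span {chartBase yy 1 C ^ (k + 2)} := by
    intro k
    rw [Ideal.map_sup, Ideal.map_sup, CuspMember.map_span_singleton, CuspMember.map_span_singleton,
      CuspMember.map_span_singleton, map_mul, map_pow, map_add, map_pow, map_mul, map_pow, map_pow,
      map_mul, map_pow, map_pow, cb]
    exact cSub_B' _ _ _ k
  rw [Ideal.map_mul, Ideal.map_mul, CoreRungTower.map_prod_range, hS, hK]
  simp_rw [hB]
  rw [Ideal.prod_span_singleton, Finset.prod_pow_eq_pow_sum, sum_range_six,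
    Ideal.span_singleton_mul_span_singleton, Ideal.span_singleton_mul_span_singleton]

set_option maxHeartbeats 400000 in
-- instance-path defeq through `HomogeneousLocalization`'s standalone `Pow`/`Mul` (as in p508825)
/-- **THE SURFACE STEP `Π₂` AND THE TANGENT-EUCLID FINISH.** For `(a, c′)` quasi-regular with
`B/(a, c′)` regular in a regular ring `B`, and GIVEN the two persistence facts on the `a`-chart
`B_a` of `Bl_{(a, c′)}` — `(t′/1, c″)` quasi-regular and `B_a/(t′/1, c″)` regular — every blowing up
of `Spec B` along the `a`-chart residual `F′ = (a, c′) · Σ′ · K′ · ∏ B′_k` is regular: the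
`c′`-chart is Cartier (`map_Ga_one`), the `a`-chart is `CoreRungTower.tangent_euclid_two 3`
(`map_Ga_zero`). [cite: StacksProject, Tag 080A] [cite: StacksProject, Tag 080B]
[cite: Liu2002, Thm. 8.1.19 (a)] -/
theorem isRegular_of_isBlowup_surfaceStep [IsRegularRing B] (hy : IsQuasiRegular yy)
    (hBy : IsRegularRing (B ⧸ Ideal.span (Set.range yy)))
    (hx₀ : IsQuasiRegular (![chartBase yy 0 T, chartGen yy 0 1] : Fin 2 → chartRing yy 0))
    (hR₀ : IsRegularRing (chartRing yy 0 ⧸ Ideal.span (Set.range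
      (![chartBase yy 0 T, chartGen yy 0 1] : Fin 2 → chartRing yy 0))))
    {Y : Scheme.{u}} {ρ : Y ⟶ Spec (.of B)}
    (hρ : IsBlowup ρ (affineBlowup.idealSheaf (Fa[T,C,A₁]))) : Scheme.IsRegular Y := by
  haveI := hBy
  rw [Fa_eq] at hρ
  refine isRegular_of_isBlowup_mul_of_charts yy _ (fun i Y' σ hσ => ?_) hρ
  haveI hB' : IsRegularRing (chartRing yy i) := isRegularRing_blowupChart _ i hy
  have hi : i = 0 ∨ i = 1 := by
    fin_cases i
    · exact Or.inl rfl
    · exact Or.inr rfl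
  rcases hi with rfl | rfl
  · -- `a`-chart: tangent Euclid `(2, 4)` in the letters `(t′/1, c″)`
    have hA : chartBase yy 0 A₁ ∈ (chartRing yy 0)⁰ :=
      reesChartBase_mem_nonZeroDivisors (yy 0) (Ideal.mem_span_range_self (f := yy) (x := 0))
    rw [map_Ga_zero] at hσ
    exact CoreRungTower.isRegular_of_isBlowup_span_singleton_mul
      (mul_mem (mul_mem hA (pow_mem hA 2)) (pow_mem hA 27)) _
      (fun Y'' τ hτ => CoreRungTower.tangent_euclid_two 3 (chartBase yy 0 T) (chartGen yy 0 1) 1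
        isUnit_one hx₀ hR₀ hτ) hσ
  · -- `c′`-chart: Cartier
    have hC : chartBase yy 1 C ∈ (chartRing yy 1)⁰ :=
      reesChartBase_mem_nonZeroDivisors (yy 1) (Ideal.mem_span_range_self (f := yy) (x := 1))
    rw [map_Ga_one] at hσ
    have hσ2 : IsBlowup σ (affineBlowup.idealSheaf
        (Ideal.span {chartBase yy 1 C * chartBase yy 1 C ^ 2 * chartBase yy 1 C ^ 27} * ⊤)) := by
      rwa [Ideal.mul_top]
    refine CoreRungTower.isRegular_of_isBlowup_span_singleton_mul
      (mul_mem (mul_mem hC (pow_mem hC 2)) (pow_mem hC 27)) _ (fun Y'' τ hτ => ?_) hσ2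
    rw [affineBlowup.idealSheaf_top] at hτ
    haveI : IsIso τ := hτ.isIso isEffectiveCartier_top
    haveI : IsRegularRing (CommRingCat.of (chartRing yy 1)) := hB'
    exact SectionAscent.TraceIdeal.isRegular_of_iso (asIso τ) (Scheme.isRegular_Spec _)

end Charts

end CuspDepthFour

end Summit.ResolutionOfSingularities.ResolutionOfSingularities.Theorems

end
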